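import Mathlib.LinearAlgebra.Matrix.GeneralLinearGroup.MvPolynomial
import Mathlib.LinearAlgebra.Matrix.MvPolynomial
import Mathlib.Algebra.MvPolynomial.Monad
import Mathlib.Algebra.MvPolynomial.Funext
import Mathlib.Algebra.Order.Antidiag.Finsupp
import Literature.Computability.AlgebraicComplexity.OrbitClosure
import Literature.Computability.AlgebraicComplexity.DeterminantalComplexityProofs
import HarnessLib

/-!
# Orbit closures: discharges of the named facts of `OrbitClosure.lean`

Sibling proofs file of `Literature/Computability/AlgebraicComplexity/OrbitClosure.lean`.
It discharges four named facts of that file: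

* `Literature.Computability.AlgebraicComplexity.endOrbit_subset_orbitClosure`: over an infinite field the endomorphism orbit
  `End(k^σ) · f` (all linear substitutions, invertible or not) lies in the orbit closure
  `Δ[f] = \overline{GL · f}` (Mulmuley–Sohoni 2001 §4; Landsberg 2017 §6; used by
  Bürgisser–Ikenmeyer–Panova 2019, Thm. 2.5 (arXiv v3), "substituting `X_i` with `X_i/X_{k+1}`
  and multiplying with `X_{k+1}^n` ... applying a linear map sending `X_{k+1}` to `X` and `X_i` to
  `φ_i`", to put padded power sums into `Ω_n`);
* `Literature.Computability.AlgebraicComplexity.orbitClosure_subset_of_mem`: `g ∈ Δ[f] ⇒ Δ[g] ⊆ Δ[f]` (each `B ∈ GL` acts on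
  coefficient space by a polynomial — indeed linear — map, hence Zariski-continuously);
* `Literature.Computability.AlgebraicComplexity.mem_orbitClosure_iff_homogeneous`: for `f` a form of degree `m`, membership in
  `Δ[f]` may be tested with polynomials in the degree-`m` coordinates only;
* `Literature.Computability.AlgebraicComplexity.paddedPerPoly_mem_orbitClosure_detPoly_of_hasDetRepr` (Mulmuley–Sohoni 2001,
  Prop. 4.4): over an infinite field, an affine determinantal representation of `per_n` of size
  `m ≥ n` puts the padded permanent `X₀₀^{m-n} per_n` into `Δ[det_m]`; with it the `sInf`-free
  corollary `Literature.Computability.AlgebraicComplexity.borderDetComplexityPer_le_of_hasDetRepr` (`\underline{dc}(per_n) ≤ m`).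

Proofs. (1) The coefficient `coeff d (A · f)` is a polynomial in the entries of `A` (substitute the generic matrix `Matrix.mvPolynomialX σ σ k` into `f`); composing a
test polynomial `p` on coefficient space with these gives a polynomial on matrix space vanishing on
`GL σ k`, hence identically (`MvPolynomial.eq_of_eval_eq_on_gl`, density of `GL` in `Mat` over an
infinite field). (2) For fixed `B`, `coeff d (B · q) = ∑_{|e| = |d|} coeff e q · coeff d (B · X^e)`
(the all-coordinates form of `coeff_linSubstRep_eq_sum` of `OrbitCoordinateRing.lean`, re-proved
here to keep the import light), so `p ↦ p ∘ (B ·)` is a substitution of test polynomials (`aeval_coeffVec_linSubstPullback`). (3) Substitute `X_d ↦ X_d` for `|d| = m` and `X_d ↦ 0` otherwise: on forms of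
degree `m` this does not change values. (4) Homogenise the affine entries `a₀ + ∑ a_t x_t` of the
representation `per_n = det A` with the padding variable (`a₀ X₀₀ + ∑ a_t X_{ι t}`, `ι` the block
placement): a linear substitution instance of `det_m` which agrees with `X₀₀^{m-n} per_n` wherever
`X₀₀ ≠ 0` (pull `X₀₀` out of every row, homogeneity of `per_n`), hence everywhere
(`MvPolynomial.funext`, `k` infinite); conclude by (1).

## Sources

* K. Mulmuley, M. Sohoni, *Geometric complexity theory I*, SIAM J. Comput. 31 (2001), §4
  (orbit closures `Δ[f]`, `V = Sym^m`) (key `MulmuleySohoniSIAM2001`).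
* J. M. Landsberg, *Geometry and Complexity Theory*, CUP (2017), §6 (End-orbit vs. `GL`-orbit
  closure) (key `LandsbergGCT2017`).
* P. Bürgisser, C. Ikenmeyer, G. Panova, J. AMS 32 (2019) = arXiv:1604.06431v3, Thm. 2.5 and its
  proof; §1(a) (padded permanent `X₁₁^{n-m} per_m` from a determinantal representation).
* K. Mulmuley, M. Sohoni, op. cit., Prop. 4.4 (`dc ≤ m ⇒` padded `per_n ∈ Δ[det_m]`).
-/

noncomputable section

open MvPolynomial

namespace Literature.Computability.AlgebraicComplexity

variable {k : Type*} [Field k] {σ : Type*} [Fintype σ]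

/-! ### `endOrbit_subset_orbitClosure`: the action map is polynomial in the matrix -/

/-- The *generic linear substitution* is `f` with `X i ↦ ∑ j, Y_{ji} X j`, where
`Y = Matrix.mvPolynomialX σ σ k` is the generic `σ × σ` matrix: a polynomial in `X` whose
coefficients are polynomials in the matrix entries `Y`. Specialising `Y` to `A` in it gives `A · f`
(so the action map `A ↦ A · f` is polynomial in `A`). Mulmuley–Sohoni 2001 §4.
[cite: MulmuleySohoniSIAM2001, §4] -/
theorem map_eval_genericLinSubst (f : MvPolynomial σ k) (A : Matrix σ σ k) :
    map (eval fun ij : σ × σ => A ij.1 ij.2)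
      (linSubst σ (MvPolynomial (σ × σ) k) (Matrix.mvPolynomialX σ σ k)
        (map (C : k →+* MvPolynomial (σ × σ) k) f)) = linSubst σ k A f := by
  unfold linSubst
  rw [aeval_eq_bind₁, map_bind₁, map_map]
  have hC : (eval fun ij : σ × σ => A ij.1 ij.2).comp (C : k →+* MvPolynomial (σ × σ) k) =
      RingHom.id k := by
    ext c
    simp
  have hF : (fun i : σ => map (eval fun ij : σ × σ => A ij.1 ij.2)
      (∑ j, Matrix.mvPolynomialX σ σ k j i • X j)) = fun i => ∑ j, A j i • X j := by
    funext i
    simp only [map_sum, smul_eq_C_mul, map_mul, map_C, map_X, Matrix.mvPolynomialX_apply, eval_X]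
  rw [hC, map_id, aeval_eq_bind₁, hF]

/-- `coeff d (A · f)` is the value at `A` of the `d`-th coefficient of the generic linear
substitution, a polynomial in the matrix entries. Mulmuley–Sohoni 2001 §4. [cite: MulmuleySohoniSIAM2001, §4] -/
theorem eval_coeff_genericLinSubst (f : MvPolynomial σ k) (d : σ →₀ ℕ) (A : Matrix σ σ k) :
    eval (fun ij : σ × σ => A ij.1 ij.2)
      (coeff d (linSubst σ (MvPolynomial (σ × σ) k) (Matrix.mvPolynomialX σ σ k)
        (map (C : k →+* MvPolynomial (σ × σ) k) f))) = coeff d (linSubst σ k A f) := by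
  rw [← map_eval_genericLinSubst f A, coeff_map]

/-- Pulling back a test polynomial on coefficient space along `A ↦ coeffVec (A · f)` gives a
polynomial on matrix space with the expected values. Mulmuley–Sohoni 2001 §4. [cite: MulmuleySohoniSIAM2001, §4] -/
theorem aeval_aeval_coeff_genericLinSubst (f : MvPolynomial σ k) (p : MvPolynomial (σ →₀ ℕ) k)
    (A : Matrix σ σ k) :
    aeval (fun ij : σ × σ => A ij.1 ij.2)
      (aeval (fun d : σ →₀ ℕ => coeff d (linSubst σ (MvPolynomial (σ × σ) k)
        (Matrix.mvPolynomialX σ σ k) (map (C : k →+* MvPolynomial (σ × σ) k) f))) p) =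
      aeval (coeffVec (linSubst σ k A f)) p := by
  have hFG : (fun d : σ →₀ ℕ => aeval (fun ij : σ × σ => A ij.1 ij.2)
      (coeff d (linSubst σ (MvPolynomial (σ × σ) k) (Matrix.mvPolynomialX σ σ k)
        (map (C : k →+* MvPolynomial (σ × σ) k) f)))) = coeffVec (linSubst σ k A f) := by
    funext d
    exact eval_coeff_genericLinSubst f d A
  rw [← AlgHom.comp_apply, comp_aeval, hFG]

/-- **Discharge of `endOrbit_subset_orbitClosure`**: over an infinite field,
`End(k^σ) · f ⊆ Δ[f]`. A test polynomial vanishing on `GL · f` pulls back to a polynomial on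
`σ × σ` matrices vanishing on `GL σ k`, hence vanishing identically
(`MvPolynomial.eq_of_eval_eq_on_gl`), in particular at every `A`.
Mulmuley–Sohoni 2001 §4; Landsberg 2017 §6. [cite: MulmuleySohoniSIAM2001, §4] -/
theorem endOrbit_subset_orbitClosure_holds [DecidableEq σ] :
    endOrbit_subset_orbitClosure (k := k) (σ := σ) := by
  intro _ f g hg
  obtain ⟨A, rfl⟩ := hg
  rw [mem_orbitClosure_iff]
  intro p hp
  have hzero : aeval (fun d : σ →₀ ℕ => coeff d (linSubst σ (MvPolynomial (σ × σ) k)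
      (Matrix.mvPolynomialX σ σ k) (map (C : k →+* MvPolynomial (σ × σ) k) f))) p = 0 := by
    apply MvPolynomial.eq_of_eval_eq_on_gl
    intro g
    rw [map_zero, ← coe_aeval_eq_eval]
    exact (aeval_aeval_coeff_genericLinSubst f p (g : Matrix σ σ k)).trans (hp _ ⟨g, rfl⟩)
  refine (aeval_aeval_coeff_genericLinSubst f p A).symm.trans ?_
  rw [hzero, map_zero]

/-! ### `orbitClosure_subset_of_mem`: transitivity of degeneration -/

section Transitivity

variable [DecidableEq σ]

/-- Expansion of the substitution action in the monomial basis, on all coordinates: for every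
`q` and every monomial `d`, `coeff d (B · q) = ∑_{|e| = |d|} coeff e q · coeff d (B · X^e)`, the
sum running over the finite set `Finset.univ.finsuppAntidiag |d|` of monomials of degree `|d|`
(the action preserves each degree). Mulmuley–Sohoni 2001 §4 (`GL` acts linearly on `V = Sym^m`).
[cite: MulmuleySohoniSIAM2001, §4] -/
theorem coeff_linSubst_eq_sum_finsuppAntidiag (B : Matrix σ σ k) (q : MvPolynomial σ k)
    (d : σ →₀ ℕ) :
    coeff d (linSubst σ k B q) =
      ∑ e ∈ (Finset.univ : Finset σ).finsuppAntidiag d.degree,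
        coeff e q * coeff d (linSubst σ k B (monomial e 1)) := by
  set G : (σ →₀ ℕ) → k := fun e => coeff e q * coeff d (linSubst σ k B (monomial e 1)) with hG
  -- expand `q` in the monomial basis
  have hsupp : coeff d (linSubst σ k B q) = ∑ e ∈ q.support, G e := by
    conv_lhs => rw [q.as_sum]
    simp only [map_sum, coeff_sum]
    refine Finset.sum_congr rfl fun e _ => ?_
    have hsplit : (monomial e (coeff e q) : MvPolynomial σ k) = coeff e q • monomial e 1 := by
      rw [smul_monomial, smul_eq_mul, mul_one]
    rw [hsplit, map_smul, coeff_smul, smul_eq_mul]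
  -- both index sets may be enlarged to their union: `G` vanishes on the differences
  have hmem : ∀ e : σ →₀ ℕ,
      e ∈ (Finset.univ : Finset σ).finsuppAntidiag d.degree ↔ e.degree = d.degree := by
    intro e
    simp [Finset.mem_finsuppAntidiag, Finsupp.degree_eq_sum]
  have h1 : ∑ e ∈ q.support, G e =
      ∑ e ∈ q.support ∪ (Finset.univ : Finset σ).finsuppAntidiag d.degree, G e := by
    refine Finset.sum_subset Finset.subset_union_left fun e he hes => ?_
    rw [Finset.mem_union] at he
    have hdeg : e.degree = d.degree := (hmem e).mp (he.resolve_left hes)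
    simp [hG, notMem_support_iff.mp hes]
  have h2 : ∑ e ∈ (Finset.univ : Finset σ).finsuppAntidiag d.degree, G e =
      ∑ e ∈ q.support ∪ (Finset.univ : Finset σ).finsuppAntidiag d.degree, G e := by
    refine Finset.sum_subset Finset.subset_union_right fun e _ hea => ?_
    have hdeg : e.degree ≠ d.degree := fun h => hea ((hmem e).mpr h)
    have hzero : coeff d (linSubst σ k B (monomial e 1)) = 0 :=
      (linSubst_isHomogeneous B (isHomogeneous_monomial (1 : k) rfl)).coeff_eq_zero
        (Ne.symm hdeg)
    simp [hG, hzero]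
  rw [hsupp, h1, ← h2]

/-- The pull-back `p ↦ p ∘ (B ·)` of test polynomials on coefficient space along the action of a
fixed matrix `B` is the substitution of the linear form `∑_{|e| = |d|} coeff d (B · X^e) • X_e` for
`X_d`; its values: `(p ∘ (B ·))(h) = p(B · h)` on coefficient vectors. Mulmuley–Sohoni 2001 §4.
[cite: MulmuleySohoniSIAM2001, §4] -/
theorem aeval_coeffVec_linSubstPullback (B : Matrix σ σ k) (h : MvPolynomial σ k)
    (p : MvPolynomial (σ →₀ ℕ) k) :
    aeval (coeffVec h) (aeval (fun d : σ →₀ ℕ =>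
      ∑ e ∈ (Finset.univ : Finset σ).finsuppAntidiag d.degree,
        coeff d (linSubst σ k B (monomial e 1)) • (X e : MvPolynomial (σ →₀ ℕ) k)) p) =
      aeval (coeffVec (linSubst σ k B h)) p := by
  have hFG : (fun d : σ →₀ ℕ => aeval (coeffVec h)
      (∑ e ∈ (Finset.univ : Finset σ).finsuppAntidiag d.degree,
        coeff d (linSubst σ k B (monomial e 1)) • (X e : MvPolynomial (σ →₀ ℕ) k))) =
      coeffVec (linSubst σ k B h) := by
    funext d
    simp only [map_sum, map_smul, aeval_X, coeffVec_apply, smul_eq_mul]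
    rw [coeff_linSubst_eq_sum_finsuppAntidiag]
    exact Finset.sum_congr rfl fun e _ => mul_comm _ _
  rw [← AlgHom.comp_apply, comp_aeval, hFG]

/-- **Discharge of `orbitClosure_subset_of_mem`**: `g ∈ Δ[f] ⇒ Δ[g] ⊆ Δ[f]`. If `p` vanishes on
`GL · f` then so does `p ∘ (B ·)` for `B ∈ GL` (the orbit is `B`-stable), hence `p ∘ (B ·)` vanishes
at `g`, i.e. `p` vanishes on `GL · g` and therefore on `Δ[g]`. Mulmuley–Sohoni 2001 §4.
[cite: MulmuleySohoniSIAM2001, §4] -/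
theorem orbitClosure_subset_of_mem_holds : orbitClosure_subset_of_mem (k := k) (σ := σ) := by
  intro f g hg q hq
  rw [mem_orbitClosure_iff] at hg hq ⊢
  intro p hp
  apply hq p
  rintro _ ⟨B, rfl⟩
  dsimp only
  rw [linSubstRep_apply, ← aeval_coeffVec_linSubstPullback]
  apply hg
  rintro _ ⟨A, rfl⟩
  dsimp only
  rw [aeval_coeffVec_linSubstPullback, linSubstRep_apply, ← AlgHom.comp_apply, ← linSubst_mul]
  exact hp _ ⟨B * A, rfl⟩

end Transitivity

/-! ### `mem_orbitClosure_iff_homogeneous`: testing with degree-`m` coordinates -/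

section DegreeCoords

variable [DecidableEq σ]

/-- Testing membership in `Δ[f]`, `f` a form of degree `m`, with polynomials in a sub-family of
coordinates containing all degree-`m` monomials (general form used for both the coordinates
`{d // d.degree = m}` of `OrbitClosure.lean` and `DegIdx σ m` of `OrbitCoordinateRing.lean`).
Mulmuley–Sohoni 2001 §4 (`V = Sym^m`). [cite: MulmuleySohoniSIAM2001, §4] -/
theorem mem_orbitClosure_iff_of_subtype {P : (σ →₀ ℕ) → Prop} [DecidablePred P] {m : ℕ}
    (hP : ∀ d : σ →₀ ℕ, d.degree = m → P d) {f g : MvPolynomial σ k} (hf : f.IsHomogeneous m) :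
    g ∈ orbitClosure f ↔ g.IsHomogeneous m ∧
      ∀ p : MvPolynomial {d : σ →₀ ℕ // P d} k,
        (∀ h ∈ glOrbit σ k f, aeval (fun d => coeffVec h d.1) p = 0) →
          aeval (fun d => coeffVec g d.1) p = 0 := by
  constructor
  · intro hg
    refine ⟨hf.of_mem_orbitClosure hg, fun p hp => ?_⟩
    have := (mem_orbitClosure_iff.mp hg) (rename Subtype.val p) fun h hh => by
      rw [aeval_rename]; exact hp h hh
    rwa [aeval_rename] at this
  · rintro ⟨hgm, H⟩
    rw [mem_orbitClosure_iff]
    intro p hp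
    -- project the test polynomial to the `P`-coordinates
    let proj : (σ →₀ ℕ) → MvPolynomial {d : σ →₀ ℕ // P d} k :=
      fun d => if h : P d then X ⟨d, h⟩ else 0
    have hproj : ∀ q : MvPolynomial σ k, q.IsHomogeneous m →
        aeval (fun d : {d : σ →₀ ℕ // P d} => coeffVec q d.1) (aeval proj p) =
          aeval (coeffVec q) p := by
      intro q hq
      have hFG : (fun d : σ →₀ ℕ => aeval (fun d' : {d : σ →₀ ℕ // P d} => coeffVec q d'.1)
          (proj d)) = coeffVec q := by
        funext d
        by_cases hd : P d
        · simp [proj, hd]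
        · have hdeg : d.degree ≠ m := fun h => hd (hP d h)
          simp [proj, hd, hq.coeff_eq_zero hdeg]
      rw [← AlgHom.comp_apply, comp_aeval, hFG]
    rw [← hproj g hgm]
    apply H
    rintro _ ⟨A, rfl⟩
    dsimp only
    rw [hproj _ (by rw [linSubstRep_apply]; exact linSubst_isHomogeneous _ hf)]
    exact hp _ ⟨A, rfl⟩

/-- **Discharge of `mem_orbitClosure_iff_homogeneous`**: for `f` homogeneous of degree `m`,
`g ∈ Δ[f]` iff `g` is homogeneous of degree `m` and every polynomial in the degree-`m`
coordinates vanishing on `GL · f` vanishes at `g`. Mulmuley–Sohoni 2001 §4 (`V = Sym^m`).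
[cite: MulmuleySohoniSIAM2001, §4] -/
theorem mem_orbitClosure_iff_homogeneous_holds :
    mem_orbitClosure_iff_homogeneous (k := k) (σ := σ) :=
  fun hf => mem_orbitClosure_iff_of_subtype (P := fun d => d.degree = _) (fun _ h => h) hf

end DegreeCoords

/-! ### `paddedPerPoly_mem_orbitClosure_detPoly_of_hasDetRepr`: homogenising a determinantal
representation (Mulmuley–Sohoni 2001, Prop. 4.4) -/

section PaddedDetRepr

/-- Evaluation of an affine polynomial (total degree `≤ 1`): `a(z) = a₀ + ∑_t a_t z_t` with
`a₀ = coeff 0 a` and `a_t = coeff (single t 1) a`. [folklore] -/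
theorem eval_eq_of_totalDegree_le_one {τ : Type*} [Fintype τ] [DecidableEq τ]
    {a : MvPolynomial τ k} (ha : a.totalDegree ≤ 1) (z : τ → k) :
    eval z a = coeff 0 a + ∑ t, coeff (Finsupp.single t 1) a * z t := by
  classical
  have hcase : ∀ e ∈ a.support, e = 0 ∨ ∃ t, e = Finsupp.single t 1 := by
    intro e he
    have hdeg : (e.sum fun _ n => n) ≤ 1 := (le_totalDegree he).trans ha
    rcases Nat.le_one_iff_eq_zero_or_eq_one.mp hdeg with h0 | h1
    · left
      exact (Finsupp.degree_eq_zero_iff e).mp h0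
    · right
      exact (Finsupp.sum_eq_one_iff e).mp h1
  set S : Finset (τ →₀ ℕ) :=
    insert 0 (Finset.univ.image fun t : τ => Finsupp.single t 1) with hS
  have hsub : a.support ⊆ S := by
    intro e he
    rcases hcase e he with rfl | ⟨t, rfl⟩
    · exact Finset.mem_insert_self _ _
    · exact Finset.mem_insert_of_mem (Finset.mem_image_of_mem _ (Finset.mem_univ t))
  rw [eval_eq, Finset.sum_subset hsub (fun e _ he => by simp [notMem_support_iff.mp he])]
  have h0 : (0 : τ →₀ ℕ) ∉ Finset.univ.image fun t : τ => Finsupp.single t 1 := by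
    simp only [Finset.mem_image, Finset.mem_univ, true_and, not_exists]
    intro t ht
    exact one_ne_zero (Finsupp.single_eq_zero.mp ht)
  rw [hS, Finset.sum_insert h0,
    Finset.sum_image fun t _ t' _ h => Finsupp.single_left_injective one_ne_zero h]
  simp

/-- Homogeneous polynomials scale: `p(c • x) = c^n p(x)` for `p` homogeneous of degree `n`.
[folklore] -/
theorem eval_smul_of_isHomogeneous {τ : Type*} {p : MvPolynomial τ k} {n : ℕ}
    (hp : p.IsHomogeneous n) (c : k) (x : τ → k) :
    eval (c • x) p = c ^ n * eval x p := by
  classical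
  rw [eval_eq, eval_eq, Finset.mul_sum]
  refine Finset.sum_congr rfl fun d hd => ?_
  have hdeg : ∑ i ∈ d.support, d i = n := by
    have := hp (mem_support_iff.mp hd)
    simpa [Finsupp.weight_apply, Finsupp.sum] using this
  simp only [Pi.smul_apply, smul_eq_mul, mul_pow, Finset.prod_mul_distrib,
    Finset.prod_pow_eq_pow_sum, hdeg]
  ring

/-- The generic permanent is natural under bijections of the index type. [folklore] -/
theorem rename_perPoly_equiv {n n' : Type*} [Fintype n] [DecidableEq n] [Fintype n']
    [DecidableEq n'] (e : n ≃ n') :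
    rename (Prod.map e e) (perPoly n k) = perPoly n' k := by
  simp only [perPoly, Matrix.permanent, map_sum, map_prod, Matrix.mvPolynomialX_apply, rename_X,
    Prod.map_apply]
  refine Fintype.sum_equiv (e.permCongr) _ _ fun π => ?_
  refine Fintype.prod_equiv e _ _ fun i => ?_
  simp [Equiv.permCongr_apply]

/-- **Homogenised determinantal representations lie in the endomorphism orbit of `det_m`.**
If a form `q` of degree `s ≤ m` has an affine determinantal representation of size `m`, then for
any placement `ι` of its variables among the `m²` matrix variables and any matrix variable `X_y`,
the padded form `X_y^{m-s} · q(X_ι)` is a linear substitution instance of `det_m`: homogenise the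
affine entries with `X_y` (entry `a₀ + ∑ a_t x_t ↦ a₀ X_y + ∑ a_t X_{ι t}`); the resulting
determinant agrees with `X_y^{m-s} q(X_ι)` wherever `X_y ≠ 0` (pull out `X_y` from every row and
use homogeneity of `q`), hence everywhere (`k` infinite). Mulmuley–Sohoni 2001, Prop. 4.4;
Bürgisser–Ikenmeyer–Panova 2019 (arXiv v3) §1(a) and proof of Thm. 2.5.
[cite: MulmuleySohoniSIAM2001, Prop. 4.4] -/
theorem X_pow_mul_rename_mem_endOrbit_detPoly [Infinite k] {τ : Type*} [Fintype τ]
    [DecidableEq τ] {q : MvPolynomial τ k} {s m : ℕ} (hq : q.IsHomogeneous s) (hsm : s ≤ m)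
    (hA : HasDetRepr q m) (ι : τ → Fin m × Fin m) (y : Fin m × Fin m) :
    X y ^ (m - s) * rename ι q ∈ endOrbit (Fin m × Fin m) k (detPoly (Fin m) k) := by
  classical
  obtain ⟨A, hAdeg, hAdet⟩ := hA
  -- the homogenising substitution matrix
  set M : Matrix (Fin m × Fin m) (Fin m × Fin m) k := fun p ij =>
    (if p = y then coeff 0 (A ij.1 ij.2) else 0) +
      ∑ t, if p = ι t then coeff (Finsupp.single t 1) (A ij.1 ij.2) else 0 with hM
  refine ⟨M, ?_⟩
  -- values of the substituted entries where `x y ≠ 0`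
  have hentry : ∀ (x : Fin m × Fin m → k), x y ≠ 0 → ∀ i j : Fin m,
      eval x (linSubst _ k M (X (i, j))) = x y * eval (fun t => x (ι t) / x y) (A i j) := by
    intro x hx i j
    rw [linSubst_X, map_sum, eval_eq_of_totalDegree_le_one (hAdeg i j)]
    simp only [smul_eval, eval_X, hM, add_mul, Finset.sum_add_distrib, Finset.sum_mul, ite_mul,
      zero_mul]
    rw [Finset.sum_comm]
    simp only [mul_add, Finset.mul_sum]
    congr 1
    · rw [Finset.sum_ite_eq' Finset.univ y, if_pos (Finset.mem_univ _)]
      ring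
    · refine Finset.sum_congr rfl fun t _ => ?_
      rw [Finset.sum_ite_eq' Finset.univ (ι t), if_pos (Finset.mem_univ _)]
      field_simp
  -- values of the substituted determinant where `x y ≠ 0`
  have hdet : ∀ (x : Fin m × Fin m → k), x y ≠ 0 →
      eval x (linSubst _ k M (detPoly (Fin m) k)) = x y ^ (m - s) * eval (x ∘ ι) q := by
    intro x hx
    have hmat : ((Matrix.mvPolynomialX (Fin m) (Fin m) k).map (linSubst _ k M)).map (eval x) =
        x y • A.map (eval fun t => x (ι t) / x y) := by
      ext i j
      simp only [Matrix.map_apply, Matrix.mvPolynomialX_apply, Matrix.smul_apply, smul_eq_mul]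
      exact hentry x hx i j
    rw [detPoly, AlgHom.map_det, RingHom.map_det, AlgHom.mapMatrix_apply, RingHom.mapMatrix_apply,
      hmat, Matrix.det_smul, Fintype.card_fin, ← RingHom.mapMatrix_apply, ← RingHom.map_det, hAdet]
    have hscale : (fun t => x (ι t) / x y) = (x y)⁻¹ • (x ∘ ι) := by
      funext t
      simp [div_eq_inv_mul]
    rw [hscale, eval_smul_of_isHomogeneous hq, ← mul_assoc]
    congr 1
    rw [← Nat.sub_add_cancel hsm, pow_add, Nat.add_sub_cancel, mul_assoc, ← mul_pow,
      mul_inv_cancel₀ hx, one_pow, mul_one]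
  -- the two polynomials agree where `x y ≠ 0`, hence everywhere
  have hprod : (linSubst _ k M (detPoly (Fin m) k) - X y ^ (m - s) * rename ι q) * X y = 0 := by
    apply MvPolynomial.funext
    intro x
    rw [map_mul, map_sub, map_zero, eval_X]
    by_cases hx : x y = 0
    · rw [hx, mul_zero]
    · rw [hdet x hx, map_mul, map_pow, eval_X, eval_rename, sub_self, zero_mul]
  have hX : (X y : MvPolynomial (Fin m × Fin m) k) ≠ 0 := X_ne_zero y
  exact (sub_eq_zero.mp ((mul_eq_zero.mp hprod).resolve_right hX))

/-- **Discharge of `paddedPerPoly_mem_orbitClosure_detPoly_of_hasDetRepr`** (Mulmuley–Sohoni 2001,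
Prop. 4.4; BLMW 2011 §2): over an infinite field, an affine determinantal representation
`per_n = det (A₀ + A₁(x))` of size `m ≥ n` yields `X₀₀^{m-n} per_n ∈ Δ[det_m]`: homogenise
(`X_pow_mul_rename_mem_endOrbit_detPoly`, with the block placement of the variables of `per_n`)
and use `End · det_m ⊆ Δ[det_m]` (`endOrbit_subset_orbitClosure_holds`).
[cite: MulmuleySohoniSIAM2001, Prop. 4.4] -/
theorem paddedPerPoly_mem_orbitClosure_detPoly_of_hasDetRepr_holds :
    paddedPerPoly_mem_orbitClosure_detPoly_of_hasDetRepr (k := k) := by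
  intro _ n m _ h hnm
  classical
  -- the block index type has `n` elements
  set e : Fin n ≃ BlockIdx n m := (Fintype.equivFinOfCardEq (card_blockIdx hnm)).symm with he
  have hper : perPoly (BlockIdx n m) k = rename (Prod.map e e) (perPoly (Fin n) k) :=
    (rename_perPoly_equiv e).symm
  refine endOrbit_subset_orbitClosure_holds _ ?_
  rw [paddedPerPoly, hper, rename_rename]
  have hhom : (perPoly (Fin n) k).IsHomogeneous n := by
    simpa using (perPoly_isHomogeneous (n := Fin n) (k := k))
  exact X_pow_mul_rename_mem_endOrbit_detPoly hhom hnm h _ _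

/-- **Discharge of `borderDetComplexityPer_le_of_hasDetRepr`**: over an infinite field, an affine
determinantal representation of `per_n` of size `m ≥ n`, `m ≥ 1`, gives `\underline{dc}(per_n) ≤ m`
(`m` lies in the set whose `sInf` defines `borderDetComplexityPer`, by
`paddedPerPoly_mem_orbitClosure_detPoly_of_hasDetRepr_holds`). Mulmuley–Sohoni 2001, Prop. 4.4;
Landsberg 2017 §6. [cite: MulmuleySohoniSIAM2001, Prop. 4.4] -/
theorem borderDetComplexityPer_le_of_hasDetRepr_holds :
    borderDetComplexityPer_le_of_hasDetRepr (k := k) := by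
  intro _ n m _ h hnm
  exact Nat.sInf_le ⟨Nat.pos_of_ne_zero (NeZero.ne m), hnm,
    paddedPerPoly_mem_orbitClosure_detPoly_of_hasDetRepr_holds h hnm⟩

end PaddedDetRepr

end Literature.Computability.AlgebraicComplexity

/-! ## Appendix (2026-08-15): `max n 1 ≤ \underline{dc}(per_n)` — the infimum defining
`borderDetComplexityPer` is attained

Discharges of the named facts `max_le_borderDetComplexityPer` and `le_borderDetComplexityPer` of
`OrbitClosure.lean` (their preserved interim proofs, now fed by discharged ingredients). The set
`{m | 0 < m ∧ n ≤ m ∧ X₀₀^{m-n} per_n ∈ Δ[det_m]}` whose infimum is `\underline{dc}(per_n)` is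
nonempty over an infinite field: Valiant's universality of the determinant
(`exists_hasDetRepr_holds`, `DeterminantalComplexityProofs.lean`) gives an affine determinantal
representation of `per_n` of some size `m₀`; padding (`HasDetRepr.mono_holds`) raises the size to
`m = max m₀ (n + 1)`; Mulmuley–Sohoni 2001, Prop. 4.4
(`paddedPerPoly_mem_orbitClosure_detPoly_of_hasDetRepr_holds` above: `per_n = det A` with `A`
affine of size `m ≥ n` `⇒ X₀₀^{m-n} per_n ∈ Δ[det_m]`) puts `m` in the set. Hence the infimum is
attained (`hasBorderDetRepr_borderDetComplexityPer`), and every element of the set is `≥ max n 1`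
by definition. (The bare nonemptiness statement, the named fact `exists_hasBorderDetRepr`, is
already discharged downstream as `Literature.Computability.Complexity.exists_hasBorderDetRepr_holds`
in `Complexity/OccurrenceObstructionsFresh.lean`, by the same argument; it is not re-declared here.)

Sources: K. Mulmuley, M. Sohoni, SIAM J. Comput. 31 (2001), §4 and Prop. 4.4
(key `MulmuleySohoniSIAM2001`); P. Bürgisser, C. Ikenmeyer, G. Panova, J. AMS 32 (2019) =
arXiv:1604.06431v3, §1, p. 2 ("It is known [Val:79a] that `dc(f) ≤ s + 1` if `f` has a formula of
size `s`"; "using that `GL_{n²}` is dense in `ℂ^{n²×n²}`, one shows that `dc(per_m) ≤ n` implies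
`X_{11}^{n-m} per_m ∈ \overline{GL_{n²} det_n}`") (key `BurgisserIkenmeyerPanovaJAMS2019`);
L. G. Valiant, STOC 1979, Thm. 1 (key `ValiantSTOC1979`).
-/

namespace Literature.Computability.AlgebraicComplexity

section BorderDcBounds

variable {k : Type*} [Field k]

/-- Over an infinite field the infimum defining `\underline{dc}(per_n)` is attained: with
`m = borderDetComplexityPer k n` one has `0 < m`, `n ≤ m` and `X₀₀^{m-n} per_n ∈ Δ[det_m]`.
`Nat.sInf_mem` on the defining set, which is nonempty: Valiant universality
(`exists_hasDetRepr_holds`: `per_n = det A`, `A` affine of some size `m₀`), padding to size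
`max m₀ (n + 1)` (`HasDetRepr.mono_holds`) and Mulmuley–Sohoni 2001, Prop. 4.4
(`paddedPerPoly_mem_orbitClosure_detPoly_of_hasDetRepr_holds`); cf. Bürgisser–Ikenmeyer–Panova
2019 §1 ("`dc(per_m) ≤ n` implies `X_{11}^{n-m} per_m ∈ Ω_n`"). [cite: MulmuleySohoniSIAM2001, Prop. 4.4] -/
theorem hasBorderDetRepr_borderDetComplexityPer [Infinite k] (n : ℕ) :
    ∃ h : 0 < borderDetComplexityPer k n, n ≤ borderDetComplexityPer k n ∧
      (haveI := NeZero.of_pos h; HasBorderDetRepr k n (borderDetComplexityPer k n)) := by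
  -- nonemptiness of the defining set (the preserved interim proof of `exists_hasBorderDetRepr`)
  have hne : {m : ℕ | ∃ h : 0 < m, n ≤ m ∧
      (haveI := NeZero.of_pos h; HasBorderDetRepr k n m)}.Nonempty := by
    obtain ⟨m, hm⟩ := exists_hasDetRepr_holds (perPoly (Fin n) k)
    refine ⟨max m (n + 1), by omega, by omega, ?_⟩
    haveI : NeZero (max m (n + 1)) := NeZero.of_pos (by omega)
    exact paddedPerPoly_mem_orbitClosure_detPoly_of_hasDetRepr_holds
      (HasDetRepr.mono_holds hm (le_max_left _ _)) (by omega)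
  exact Nat.sInf_mem hne

/-- **Discharge of `max_le_borderDetComplexityPer`**: over an infinite field,
`max n 1 ≤ \underline{dc}(per_n)`, i.e. `n ≤ \underline{dc}(per_n)` and `1 ≤ \underline{dc}(per_n)`:
the infimum defining `borderDetComplexityPer k n` is attained
(`hasBorderDetRepr_borderDetComplexityPer`) and every element `m` of the defining set satisfies
`0 < m` and `n ≤ m` by definition (in print `m ≥ n` is implicit in the padding `X₀₀^{m-n} per_n`:
Mulmuley–Sohoni 2001 §4; Bürgisser–Ikenmeyer–Panova 2019 §1, "for `n > m` we consider the padded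
permanent `X_{11}^{n-m} per_m`"). The preserved interim proof of `OrbitClosure.lean`.
[cite: MulmuleySohoniSIAM2001, §4] -/
theorem max_le_borderDetComplexityPer_holds : max_le_borderDetComplexityPer (k := k) := by
  intro _ n
  obtain ⟨hpos, hle, -⟩ := hasBorderDetRepr_borderDetComplexityPer (k := k) n
  exact max_le hle hpos

/-- **Discharge of `le_borderDetComplexityPer`**: over an infinite field, `n ≤ \underline{dc}(per_n)`
(the left half of `max_le_borderDetComplexityPer_holds`; its preserved interim proof).
Mulmuley–Sohoni 2001 §4. [cite: MulmuleySohoniSIAM2001, §4] -/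
theorem le_borderDetComplexityPer_holds : le_borderDetComplexityPer (k := k) := by
  intro _ n
  exact le_of_max_le_left (max_le_borderDetComplexityPer_holds n)

/-- Over an infinite field, `0 < \underline{dc}(per_n)`: `borderDetComplexityPer k n` is never the
junk value `0` of the `sInf` (the right half of `max_le_borderDetComplexityPer_holds`).
Mulmuley–Sohoni 2001 §4. [cite: MulmuleySohoniSIAM2001, §4] -/
theorem borderDetComplexityPer_pos [Infinite k] (n : ℕ) : 0 < borderDetComplexityPer k n :=
  le_of_max_le_right (max_le_borderDetComplexityPer_holds n)

end BorderDcBounds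

end Literature.Computability.AlgebraicComplexity

/-! ## Appendix (2026-08-15, ii): `\underline{dc}(per_n) ≤ dc(per_n)` — discharge of
`borderDetComplexityPer_le`

The named fact `Literature.Computability.AlgebraicComplexity.borderDetComplexityPer_le` of
`OrbitClosure.lean` says: over an infinite field `k` and for `n ≥ 1`,
`borderDetComplexityPer k n ≤ determinantalComplexity (perPoly (Fin n) k)`, i.e. the border
determinantal complexity of the permanent is at most its determinantal complexity.

Printed sources. Mulmuley–Sohoni 2001, Prop. 4.4 (`dc(per_n) ≤ m` puts the padded permanent into
`Δ[det_m]`); Landsberg 2017, §1.2.4–§1.2.5: eq. (1.2.4)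
"`dc(perm_m) ≤ n ⟺ ℓ^{n-m} perm_m ∈ End(ℂ^{n²}) · det_n`", Def. 1.2.5.1 (`\overline{dc}(p)` = the
least `n` with `ℓ^{n-d} p ∈ \overline{End(ℂ^{n²}) · det_n}`), and §6.1.6
("`\overline{GL_{n²} · [det_n]} = \overline{End(ℂ^{n²}) · [det_n]}` … so Conjecture 6.1.6.2 is a
strengthening of Conjecture 6.1.6.1"), whence `\overline{dc} ≤ dc` (§6.7 then asks for sequences
with `dc(P_m) > \overline{dc}(P_m)`).

Proof formalised (the preserved interim proof of `OrbitClosure.lean`, fed by discharged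
ingredients). Let `m = dc(per_n)`; the infimum is attained
(`hasDetRepr_determinantalComplexity_holds`, resting on Valiant universality
`exists_hasDetRepr_holds`), so `per_n` has an affine determinantal representation of size `m`.
Moreover `n = deg per_n ≤ m` (`per_n` is a nonzero form of degree `n`, `perPoly_isHomogeneous`,
and `totalDegree_le_determinantalComplexity_holds`), in particular `m ≥ 1` as `n ≥ 1`. Then
`borderDetComplexityPer_le_of_hasDetRepr_holds` (the homogenisation argument of Mulmuley–Sohoni
2001, Prop. 4.4, proved above) gives `\underline{dc}(per_n) ≤ m`. The hypothesis `0 < n` of the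
fact is exactly what makes `m ≥ 1` (for `n = 0`, `dc per_0 = dc 1 = 0` via the empty matrix while
`\underline{dc}(per_0) = 1`).
-/

namespace Literature.Computability.AlgebraicComplexity

section BorderLeDc

variable {k : Type*} [Field k]

/-- Over a field, `n ≤ dc(per_n)`: `deg per_n = n` (a nonzero form of degree `n`; Bürgisser 2000,
§2.1) and `deg f ≤ dc f` (`totalDegree_le_determinantalComplexity_holds`; Mignon–Ressayre 2004,
§1: a determinant of `m` affine linear forms has degree `≤ m`). [cite: MignonRessayre2004, §1] -/
theorem le_determinantalComplexity_perPoly (n : ℕ) :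
    n ≤ determinantalComplexity (perPoly (Fin n) k) := by
  -- `per_n ≠ 0`: its value at the identity matrix is `per 1 = 1` (cf. `perPoly_ne_zero` of
  -- `StandardFamiliesProofs.lean`, not imported here)
  have hne : perPoly (Fin n) k ≠ 0 := by
    intro h
    have h1 := eval_perPoly (n := Fin n) (k := k) fun ij => if ij.1 = ij.2 then 1 else 0
    have h2 : (Matrix.of fun i j : Fin n => if (i, j).1 = (i, j).2 then (1 : k) else 0) = 1 := by
      ext i j
      simp [Matrix.one_apply]
    rw [h, map_zero, h2, Matrix.permanent_one] at h1
    exact zero_ne_one h1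
  have hdeg : (perPoly (Fin n) k).totalDegree = Fintype.card (Fin n) :=
    perPoly_isHomogeneous.totalDegree hne
  have h := totalDegree_le_determinantalComplexity_holds (perPoly (Fin n) k)
  rw [hdeg, Fintype.card_fin] at h
  exact h

/-- **Discharge of `borderDetComplexityPer_le`**: over an infinite field and for `n ≥ 1`,
`\underline{dc}(per_n) ≤ dc(per_n)`. With `m = dc(per_n)`, the permanent has an affine
determinantal representation of size `m` (`hasDetRepr_determinantalComplexity_holds`) and
`1 ≤ n ≤ m` (`le_determinantalComplexity_perPoly`), so the homogenised representation puts
`X₀₀^{m-n} per_n` into `Δ[det_m]` and `\underline{dc}(per_n) ≤ m`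
(`borderDetComplexityPer_le_of_hasDetRepr_holds`). Mulmuley–Sohoni 2001, Prop. 4.4;
Landsberg 2017, eq. (1.2.4), Def. 1.2.5.1 and §6.1.6
(`\overline{End · det_n} = \overline{GL · det_n}`).
[cite: MulmuleySohoniSIAM2001, Prop. 4.4] -/
theorem borderDetComplexityPer_le_holds : borderDetComplexityPer_le (k := k) := by
  intro _ n hn
  have hle : n ≤ determinantalComplexity (perPoly (Fin n) k) :=
    le_determinantalComplexity_perPoly n
  haveI : NeZero (determinantalComplexity (perPoly (Fin n) k)) := NeZero.of_pos (by omega)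
  exact borderDetComplexityPer_le_of_hasDetRepr_holds
    (hasDetRepr_determinantalComplexity_holds _) hle

end BorderLeDc

end Literature.Computability.AlgebraicComplexity
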